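import Literature.NumberTheory.LFunctions.HybridCharSumRoots
import Literature.NumberTheory.LFunctions.HybridCharSumArtinSchreier
import Literature.NumberTheory.LFunctions.StepanovAuxPoly
import Literature.NumberTheory.LFunctions.PowerSumsBound
import HarnessLib

/-!
# The Weil bound for twisted quadratic character sums of split polynomials, by Stepanov's method
# (Schmidt, Ch. II, Theorem 2G for `d = 2`, `deg g = 1`)

Topic `Literature/NumberTheory/LFunctions` (exponential sums), grouping namespace `HybridLFunction`.
W. M. Schmidt, *Equations over Finite Fields. An Elementary Approach*, LNM 536 (1976), Ch. II §2,
**Theorem 2G**: for a multiplicative character `χ ≠ χ₀` of order `d`, an additive character `ψ ≠ ψ₀`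
of `𝔽_q`, `f` not a `d`-th power with `m` distinct roots and `deg g = n` with `(n, q) = 1`,
`|Σ_{x ∈ 𝔽_q} χ(f(x)) ψ(g(x))| ≤ (m + n − 1) q^{1/2}`; with A. Weil, *On some exponential sums*,
Proc. Nat. Acad. Sci. USA 34 (1948) 204–207. We PROVE the case `d = 2`, `g = bX` (`n = 1`, and
also `b = 0`), `f = c Π_{i<ℓ} (X − r_i)` split with distinct roots, by the elementary route of
Schmidt's book:

* `norm_sum_extSum_le` — Stepanov's theorem (the tree's `Stepanov.theorem_I_2A_two_of_lemma3B`
  with `Stepanov.lemma3B`, Schmidt I Theorem 2A) for the hyperelliptic curve `y² = f(z^q − z)`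
  over `E ⊇ F` bounds ALL twists at once: `‖Σ_{β ∈ F} S_E(β)‖ ≤ 4·2^{3/2}·ℓq·√#E` once
  `#E > 200 ℓ²q²` (`HybridCharSumArtinSchreier.lean`);
* since `S_E(β) = psumOf λ_β [E:F] = −Σ_{j<ℓ} ω_{β,j}^{[E:F]}` (`HybridCharSumExtension.lean`,
  `HybridCharSumRoots.lean`) and `F` has extensions of every degree (Mathlib's
  `FiniteField.Extension`), Schmidt's Lemma 6A (the tree's `norm_le_of_norm_powerSum_le`) applied
  to the `qℓ` numbers `ω_{β,j}` gives `|ω_{β,j}| ≤ √q` for all of them;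
* **`norm_hybridSum_le`** — `‖Σ_{x ∈ F} χ(c Π_{i<ℓ} (x − r_i)) ψ₀(bx)‖ ≤ ℓ √q` for the quadratic
  character `χ` of a finite field `F` of odd characteristic with `q` elements, `c ≠ 0`, distinct
  `r_i` (`ℓ ≥ 1`), a primitive additive character `ψ₀` and every `b ∈ F` (Theorem 2G with
  `m = ℓ`, `n = 1`; for `b = 0` this is Theorem 2C's bound `(ℓ − 1)√q` weakened to `ℓ√q`).
  [cite: Schmidt1976, Ch. II §2, Theorems 2C and 2G; §11]

This is the Weil bound "(3.13) `Σ_{n ∈ ℤ/pℤ} χ_p(f(n)) e_p(an) ≪ p^{1/2}` whenever `f` is not a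
constant multiple of a perfect square mod `p`" used by Tao–Teräväinen (arXiv:2109.06291, §3.4) for
products of distinct linear factors, the input of their Lemma 3.7
(`Literature.Barriers.Parity.TaoTeravainen2021_lemma37_k0`).

## References

* W. M. Schmidt, *Equations over Finite Fields. An Elementary Approach*, Lecture Notes in
  Math. 536, Springer (1976); 2nd ed. Kendrick Press (2004). Ch. I §2 Theorem 2A; Ch. II §2
  Theorems 2C, 2G, §6 Lemma 6A, §§9–11 (part (c) of §11: the proof of Theorem 2G).
* A. Weil, *On some exponential sums*, Proc. Nat. Acad. Sci. USA 34 (1948) 204–207.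
* T. Tao, J. Teräväinen, *The Hardy–Littlewood–Chowla conjecture in the presence of a Siegel
  zero*, J. London Math. Soc. (2) 106 (2022), §3.4 (3.13).
-/

noncomputable section

open Finset Polynomial

namespace Literature.NumberTheory.LFunctions

namespace HybridLFunction

/-! ### Stepanov's bound for the Artin–Schreier–hyperelliptic point count -/

section StepanovBound

variable (F : Type*) [Field F] [Fintype F] [DecidableEq F]
variable (E : Type*) [Field E] [Fintype E] [DecidableEq E] [Algebra F E]

/-- **All twists at once are `O(√#E)`**: for `c ≠ 0`, distinct `r_i` (`i < ℓ`, `ℓ ≥ 1`), a primitive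
`ψ₀` and `#E > 200 ℓ² q²`, `‖Σ_{β ∈ F} S_E(β)‖ ≤ 4·2^{3/2}·(ℓq)·√#E` — Stepanov's theorem (Schmidt,
Ch. I, Theorem 2A, `d = 2`) for `y² = f(z^q − z)`, a separable polynomial of degree `ℓq`.
[cite: Schmidt1976, Ch. I §2 Theorem 2A and Ch. II §11 Lemmas 11C–11E] -/
theorem norm_sum_extSum_le (hF : ringChar F ≠ 2) {ψ₀ : AddChar F ℂ} (hψ₀ : ψ₀.IsPrimitive)
    {c : F} (hc : c ≠ 0) {ℓ : ℕ} {r : Fin ℓ → F} (hr : Function.Injective r) (hℓ : 1 ≤ ℓ)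
    (hbig : 200 * ((ℓ : ℝ) * Fintype.card F) ^ 2 < Fintype.card E) :
    ‖∑ β : F, extSum ψ₀ c r β E‖ ≤
      4 * (2 : ℝ) ^ ((3 : ℝ) / 2) * (ℓ * Fintype.card F) * Real.sqrt (Fintype.card E) := by
  have hE : ringChar E ≠ 2 := by rw [← Algebra.ringChar_eq F E]; exact hF
  have hdeg : (asPoly c r : E[X]).natDegree = ℓ * Fintype.card F := natDegree_asPoly c r hc
  have h := Stepanov.theorem_I_2A_two_of_lemma3B (F := E)
    (fun ⦃f⦄ hf hq hf0 hnsq hm1 hm hmm ⦃M⦄ hM1 hMq θ =>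
      Stepanov.lemma3B hf hq hf0 hnsq hm1 hm hmm hM1 hMq θ)
    (asPoly c r : E[X]) (asPoly_ne_C_mul_sq c r hc hr hℓ) (by rw [hdeg]; push_cast; nlinarith)
  rw [hdeg] at h
  rw [sum_extSum_eq_card_sub F E c r hψ₀ hE]
  have hcast : (((univ.filter fun zy : E × E => zy.2 ^ 2 = (asPoly c r : E[X]).eval zy.1).card : ℂ)
      - (Fintype.card E : ℂ)) =
      ((((univ.filter fun zy : E × E => zy.2 ^ 2 = (asPoly c r : E[X]).eval zy.1).card : ℝ)
        - (Fintype.card E : ℝ) : ℝ) : ℂ) := by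
    push_cast; rfl
  rw [hcast, Complex.norm_real, Real.norm_eq_abs]
  push_cast at h
  exact h

end StepanovBound

/-! ### The main theorem -/

section Main

variable (F : Type*) [Field F] [Fintype F] [DecidableEq F]

omit [DecidableEq F] in
/-- A finite field of odd characteristic has at least `3` elements. [folklore] -/
theorem three_le_card (hF : ringChar F ≠ 2) : 3 ≤ Fintype.card F := by
  have h1 : 1 < Fintype.card F := Fintype.one_lt_card
  have h2 : Fintype.card F % 2 = 1 := FiniteField.odd_card_of_char_ne_two hF
  omega

/-- The numerics of the choice `ν ≥ 2ℓ + 7`: then `200 (ℓq)² < q^ν` for `q ≥ 3`. [folklore] -/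
theorem bigness {q ℓ ν : ℕ} (hq : 3 ≤ q) (hν : 2 * ℓ + 7 ≤ ν) : 200 * (ℓ * q) ^ 2 < q ^ ν := by
  have h9 : ℓ ^ 2 < 9 ^ ℓ := by
    calc ℓ ^ 2 < (2 ^ ℓ) ^ 2 := Nat.pow_lt_pow_left Nat.lt_two_pow_self two_ne_zero
      _ = 4 ^ ℓ := by rw [← pow_mul, mul_comm, pow_mul]; norm_num
      _ ≤ 9 ^ ℓ := Nat.pow_le_pow_left (by norm_num) ℓ
  have hA : 200 * ℓ ^ 2 < 3 ^ (2 * ℓ + 5) := by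
    have : 3 ^ (2 * ℓ + 5) = 243 * 9 ^ ℓ := by rw [pow_add, pow_mul]; norm_num; ring
    rw [this]
    nlinarith
  have hB : 3 ^ (2 * ℓ + 5) ≤ q ^ (2 * ℓ + 5) := Nat.pow_le_pow_left hq _
  have hC : q ^ (2 * ℓ + 7) ≤ q ^ ν := Nat.pow_le_pow_right (by omega) hν
  have hq2 : 0 < q ^ 2 := by positivity
  calc 200 * (ℓ * q) ^ 2 = (200 * ℓ ^ 2) * q ^ 2 := by ring
    _ < 3 ^ (2 * ℓ + 5) * q ^ 2 := Nat.mul_lt_mul_of_pos_right hA hq2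
    _ ≤ q ^ (2 * ℓ + 5) * q ^ 2 := Nat.mul_le_mul_right _ hB
    _ = q ^ (2 * ℓ + 7) := by rw [← pow_add]
    _ ≤ q ^ ν := hC

/-- **Schmidt, Ch. II, Theorem 2G (`d = 2`, `g = bX`, split `f`) / Weil 1948 — PROVED by
Stepanov's method.**  Let `F` be a finite field of odd characteristic with `q` elements, `χ` its
quadratic character, `ψ₀` a primitive additive character, `f = c Π_{i<ℓ} (X − r_i)` with `c ≠ 0` and
distinct `r_i ∈ F`, `ℓ ≥ 1`. Then for every `b ∈ F`,
`‖Σ_{x ∈ F} χ(f(x)) ψ₀(bx)‖ ≤ ℓ √q`.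
(Write each twisted sum and its companions over `𝔽_{q^ν}` as `−Σ_{j<ℓ} ω_{b,j}^ν`; the sum over
all `b` of the companions is the error term in the count of points on `y² = f(z^q − z)` over
`𝔽_{q^ν}`, which Stepanov's theorem bounds by `O_{ℓ,q}(q^{ν/2})`; Lemma 6A then gives
`|ω_{b,j}| ≤ √q`.) [cite: Schmidt1976, Ch. II §2 Theorems 2C, 2G and §11] -/
theorem norm_hybridSum_le (hF : ringChar F ≠ 2) {ψ₀ : AddChar F ℂ} (hψ₀ : ψ₀.IsPrimitive)
    {c : F} (hc : c ≠ 0) {ℓ : ℕ} {r : Fin ℓ → F} (hr : Function.Injective r) (hℓ : 1 ≤ ℓ)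
    (b : F) :
    ‖∑ x : F, quadChar F (c * ∏ i, (x - r i)) * ψ₀ (b * x)‖ ≤ ℓ * Real.sqrt (Fintype.card F) := by
  classical
  -- inverse roots for every twist
  have hex := fun β : F =>
    exists_hybridSum_eq_neg_sum (quadChar F) ψ₀ c r β (quadChar_ne_one F hF) hr hℓ
  choose ω hω hS using hex
  -- the prime field data needed for `FiniteField.Extension`
  haveI : Fact (ringChar F).Prime := ⟨CharP.char_is_prime F _⟩
  have hq3 : 3 ≤ Fintype.card F := three_le_card F hF
  have hqpos : (0 : ℝ) < Fintype.card F := by positivity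
  -- power sums of all the `ω_{β,j}` are Stepanov-bounded
  have hpow : ∀ ν : ℕ, 2 * ℓ + 7 ≤ ν →
      ‖∑ βj : F × Fin ℓ, ω βj.1 βj.2 ^ ν‖ ≤
        (4 * (2 : ℝ) ^ ((3 : ℝ) / 2) * (ℓ * Fintype.card F)) * Real.sqrt (Fintype.card F) ^ ν := by
    intro ν hν
    haveI : NeZero ν := ⟨by omega⟩
    let E := FiniteField.Extension F (ringChar F) ν
    letI : Fintype E := Fintype.ofFinite E
    have hfin : Module.finrank F E = ν := FiniteField.finrank_extension F (ringChar F) ν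
    have hcardE : Fintype.card E = Fintype.card F ^ ν := by
      rw [Module.card_eq_pow_finrank (K := F) (V := E), hfin]
    have h1 : ∑ β : F, extSum ψ₀ c r β E = -∑ βj : F × Fin ℓ, ω βj.1 βj.2 ^ ν := by
      rw [Fintype.sum_prod_type' fun β j => ω β j ^ ν, ← Finset.sum_neg_distrib]
      refine Finset.sum_congr rfl fun β _ => ?_
      rw [extSum_eq_psumOf ψ₀ c r β E hF, hfin, hω β ν (by omega)]
    have hbig : 200 * ((ℓ : ℝ) * Fintype.card F) ^ 2 < Fintype.card E := by
      rw [hcardE]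
      exact_mod_cast bigness hq3 hν
    have h2 := norm_sum_extSum_le F E hF hψ₀ hc hr hℓ hbig
    rw [h1, norm_neg, hcardE] at h2
    have hsq : Real.sqrt ((Fintype.card F ^ ν : ℕ) : ℝ) = Real.sqrt (Fintype.card F) ^ ν := by
      push_cast
      rw [← Real.sqrt_sq (pow_nonneg (Real.sqrt_nonneg _) ν), ← pow_mul, mul_comm, pow_mul,
        Real.sq_sqrt (Nat.cast_nonneg _)]
    rw [hsq] at h2
    exact h2
  -- Lemma 6A: every `|ω_{β,j}| ≤ √q`
  have hroot := norm_le_of_norm_powerSum_le (Finset.univ : Finset (F × Fin ℓ))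
    (fun βj => ω βj.1 βj.2) (Real.sqrt_pos.mpr hqpos) (2 * ℓ + 7) (fun ν hν => hpow ν hν)
  -- conclude for the twist `b`
  rw [hS b, norm_neg]
  calc ‖∑ j, ω b j‖ ≤ ∑ j, ‖ω b j‖ := norm_sum_le _ _
    _ ≤ ∑ _j : Fin ℓ, Real.sqrt (Fintype.card F) :=
        Finset.sum_le_sum fun j _ => hroot (b, j) (Finset.mem_univ _)
    _ = ℓ * Real.sqrt (Fintype.card F) := by
        rw [Finset.sum_const, Finset.card_univ, Fintype.card_fin, nsmul_eq_mul]

/-- The same bound with the product of linear factors written as `Π_i (x + s_i)` and an arbitrary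
leading coefficient: `‖Σ_{x ∈ F} χ(c Π_{i<ℓ} (x + s_i)) ψ₀(bx)‖ ≤ ℓ √q` for `c ≠ 0` and distinct
`s_i`. [cite: Schmidt1976, Ch. II §2 Theorem 2G] -/
theorem norm_hybridSum_add_le (hF : ringChar F ≠ 2) {ψ₀ : AddChar F ℂ} (hψ₀ : ψ₀.IsPrimitive)
    {c : F} (hc : c ≠ 0) {ℓ : ℕ} {s : Fin ℓ → F} (hs : Function.Injective s) (hℓ : 1 ≤ ℓ)
    (b : F) :
    ‖∑ x : F, quadChar F (c * ∏ i, (x + s i)) * ψ₀ (b * x)‖ ≤ ℓ * Real.sqrt (Fintype.card F) := by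
  have h := norm_hybridSum_le F hF hψ₀ hc (r := fun i => -s i) (fun i j hij => hs (neg_injective hij))
    hℓ b
  simpa only [sub_neg_eq_add] using h

end Main

end HybridLFunction

end Literature.NumberTheory.LFunctions
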